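import Mathlib
import Summits.ValiantsHypothesis.ValiantsHypothesis.Theorems.RigidityForcesSymmetryRankRigidMinimalReprLaplaceFiveSectorSplitDefs
import Summits.ValiantsHypothesis.ValiantsHypothesis.Theorems.RigidityForcesSymmetryRankRigidMinimalReprLaplaceFiveSectorSplit
import Summits.ValiantsHypothesis.ValiantsHypothesis.Theorems.RigidityForcesSymmetryRankRigidMinimalReprLaplaceFiveTriangleSeparation
import Summits.ValiantsHypothesis.ValiantsHypothesis.Theorems.RigidityForcesSymmetryRankRigidMinimalReprLaplaceFiveThreeSplitTypes
import Summits.ValiantsHypothesis.ValiantsHypothesis.Theorems.RigidityForcesSymmetryRankRigidMinimalReprLaplaceFiveSymmetricPieces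

/-!
# ValiantsHypothesis / RigidityForcesSymmetry — crux `LaplaceOptimalFive` (stmt-ValiantsHypothesis-24813), crux idea
`young-shadow` (K1): THREE-SPLIT SEPARATION in general (`stub_threeSplit_separation` of the sketch, closed by name).

A fully slot-symmetric sum `Z₁ + Z₂ + Z₃` of shadows side-symmetric for three DISTINCT pair splits `S₁, S₂, S₃` of
`Fin 5` has fully symmetric summands.  Proof: slot relabelling (`slotInv_transport`: `Z ↦ Z ∘ (· ∘ σ)` carries
`SlotInvariantOn A` to `SlotInvariantOn (σ A)`) reduces to `S₁ = {0,1}` (a permutation with `σ p = 0, σ q = 1`) and then,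
by a `decide`d classification of the remaining two splits under the stabiliser of `{0,1}`, to eight normal forms, which are
the four orbit types already separated at normalized slots (✓ `LaplaceFiveTriangleSeparation.threeSplit_separation_triangle`,
✓ `LaplaceFiveThreeSplitTypes.threeSplit_separation_star/_path/_pathEdge`) up to reordering and two further relabellings.

Honest framing.  A lemma of young-shadow's K1 programme (with ✓ `symmetricPieces_needTen` it yields Prop A on ≤ 3 splits,
typed separately); K1 `SideSymLaplaceOptimalFive`, `LaplaceOptimalFive` (OPEN · CONTESTED 72/120), `RankRigidMinimalRepr`,
`VP ≠ VNP` NOT proved.  No definitions, no `sorry`; Mathlib + tree only.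
-/

set_option linter.dupNamespace false

namespace Summit.ValiantsHypothesis.ValiantsHypothesis.Theorems.RigidityForcesSymmetryRankRigidMinimalRepr

namespace LaplaceFiveThreeSplit

open Finset LaplaceFiveSectorSplit LaplaceFiveThreeSplitTypes LaplaceFiveTriangleSeparation

/-- **Slot relabelling transport.** [folklore] -/
theorem slotInv_transport (A : Finset (Fin 5)) (Z : (Fin 5 → Fin 5) → ℂ) (σ : Equiv.Perm (Fin 5))
    (h : SlotInvariantOn A Z) : SlotInvariantOn (A.map σ.toEmbedding) (fun v => Z (v ∘ ⇑σ)) := by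
  intro τ hτ v
  show Z ((v ∘ ⇑τ) ∘ ⇑σ) = Z (v ∘ ⇑σ)
  have e : (v ∘ ⇑τ) ∘ ⇑σ = (v ∘ ⇑σ) ∘ ⇑(σ⁻¹ * τ * σ) := by
    funext i
    simp only [Function.comp, Equiv.Perm.mul_apply, Equiv.Perm.inv_def, Equiv.apply_symm_apply]
  rw [e]
  refine h _ (fun i hi => ?_) _
  have hσi : σ i ∉ A.map σ.toEmbedding := by
    rw [Finset.mem_map_equiv]
    simpa only [Equiv.symm_apply_apply] using hi
  simp only [Equiv.Perm.mul_apply, Equiv.Perm.inv_def, hτ (σ i) hσi, Equiv.symm_apply_apply]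

/-- Complements commute with relabelling. [folklore] -/
theorem map_compl_perm (A : Finset (Fin 5)) (σ : Equiv.Perm (Fin 5)) :
    (Aᶜ).map σ.toEmbedding = (A.map σ.toEmbedding)ᶜ := by
  ext x
  simp only [Finset.mem_map_equiv, Finset.mem_compl]

/-- Transport of side-symmetry of a shadow. [folklore] -/
theorem sideInv_transport (A : Finset (Fin 5)) (Z : (Fin 5 → Fin 5) → ℂ) (σ : Equiv.Perm (Fin 5))
    (h : SlotInvariantOn A Z ∧ SlotInvariantOn Aᶜ Z) :
    SlotInvariantOn (A.map σ.toEmbedding) (fun v => Z (v ∘ ⇑σ))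
      ∧ SlotInvariantOn (A.map σ.toEmbedding)ᶜ (fun v => Z (v ∘ ⇑σ)) := by
  refine ⟨slotInv_transport A Z σ h.1, ?_⟩
  rw [← map_compl_perm]
  exact slotInv_transport Aᶜ Z σ h.2

/-- Transport of full symmetry of a sum of three. [folklore] -/
theorem sum_transport (Z₁ Z₂ Z₃ : (Fin 5 → Fin 5) → ℂ) (σ : Equiv.Perm (Fin 5))
    (h : SlotInvariantOn Finset.univ (Z₁ + Z₂ + Z₃)) :
    SlotInvariantOn Finset.univ
      ((fun v => Z₁ (v ∘ ⇑σ)) + (fun v => Z₂ (v ∘ ⇑σ)) + (fun v => Z₃ (v ∘ ⇑σ))) := by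
  have := slotInv_transport Finset.univ (Z₁ + Z₂ + Z₃) σ h
  rw [Finset.map_univ_equiv] at this
  intro τ hτ v
  have h' := this τ hτ v
  simpa only [Pi.add_apply] using h'

/-- Full symmetry transports back. [folklore] -/
theorem full_transport_back (Z : (Fin 5 → Fin 5) → ℂ) (σ : Equiv.Perm (Fin 5))
    (h : SlotInvariantOn Finset.univ (fun v => Z (v ∘ ⇑σ))) : SlotInvariantOn Finset.univ Z := by
  have := slotInv_transport Finset.univ (fun v => Z (v ∘ ⇑σ)) σ⁻¹ h
  rw [Finset.map_univ_equiv] at this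
  intro τ hτ v
  have h' := this τ hτ v
  simp only [Function.comp_assoc, ← Equiv.Perm.coe_mul, inv_mul_cancel_right, inv_mul_cancel, Equiv.Perm.coe_one,
    Function.comp_id] at h'
  exact h'

/-- Transport of the whole separation problem along a relabelling `σ`: if the relabelled shadows separate, so do the
original ones. [folklore] -/
theorem separation_transport (S₁ S₂ S₃ : Finset (Fin 5)) (Z₁ Z₂ Z₃ : (Fin 5 → Fin 5) → ℂ) (σ : Equiv.Perm (Fin 5))
    (hsep : ∀ W₁ W₂ W₃ : (Fin 5 → Fin 5) → ℂ,
      (SlotInvariantOn (S₁.map σ.toEmbedding) W₁ ∧ SlotInvariantOn (S₁.map σ.toEmbedding)ᶜ W₁) →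
      (SlotInvariantOn (S₂.map σ.toEmbedding) W₂ ∧ SlotInvariantOn (S₂.map σ.toEmbedding)ᶜ W₂) →
      (SlotInvariantOn (S₃.map σ.toEmbedding) W₃ ∧ SlotInvariantOn (S₃.map σ.toEmbedding)ᶜ W₃) →
      SlotInvariantOn Finset.univ (W₁ + W₂ + W₃) →
      SlotInvariantOn Finset.univ W₁ ∧ SlotInvariantOn Finset.univ W₂ ∧ SlotInvariantOn Finset.univ W₃)
    (hZ₁ : SlotInvariantOn S₁ Z₁ ∧ SlotInvariantOn S₁ᶜ Z₁) (hZ₂ : SlotInvariantOn S₂ Z₂ ∧ SlotInvariantOn S₂ᶜ Z₂)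
    (hZ₃ : SlotInvariantOn S₃ Z₃ ∧ SlotInvariantOn S₃ᶜ Z₃) (hsum : SlotInvariantOn Finset.univ (Z₁ + Z₂ + Z₃)) :
    SlotInvariantOn Finset.univ Z₁ ∧ SlotInvariantOn Finset.univ Z₂ ∧ SlotInvariantOn Finset.univ Z₃ := by
  obtain ⟨h1, h2, h3⟩ := hsep _ _ _ (sideInv_transport S₁ Z₁ σ hZ₁) (sideInv_transport S₂ Z₂ σ hZ₂)
    (sideInv_transport S₃ Z₃ σ hZ₃) (sum_transport Z₁ Z₂ Z₃ σ hsum)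
  exact ⟨full_transport_back Z₁ σ h1, full_transport_back Z₂ σ h2, full_transport_back Z₃ σ h3⟩

/-- Reordering of the last two shadows. [folklore] -/
theorem sum_swap23 {Z₁ Z₂ Z₃ : (Fin 5 → Fin 5) → ℂ} (h : SlotInvariantOn Finset.univ (Z₁ + Z₂ + Z₃)) :
    SlotInvariantOn Finset.univ (Z₁ + Z₃ + Z₂) := by
  rw [show Z₁ + Z₃ + Z₂ = Z₁ + Z₂ + Z₃ from by abel]; exact h

/-- Cyclic reordering of the shadows. [folklore] -/
theorem sum_rot {Z₁ Z₂ Z₃ : (Fin 5 → Fin 5) → ℂ} (h : SlotInvariantOn Finset.univ (Z₁ + Z₂ + Z₃)) :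
    SlotInvariantOn Finset.univ (Z₂ + Z₃ + Z₁) := by
  rw [show Z₂ + Z₃ + Z₁ = Z₁ + Z₂ + Z₃ from by abel]; exact h

/-- The eight normal forms of three distinct pair splits with `S₁ = {0,1}`, each separated. [folklore] -/
theorem separation_normalForms (S₂ S₃ : Finset (Fin 5))
    (hform : (S₂, S₃) ∈ [(({0, 2} : Finset (Fin 5)), ({1, 2} : Finset (Fin 5))), ({0, 2}, {0, 3}), ({1, 2}, {2, 3}),
      ({2, 3}, {1, 2}), ({1, 2}, {0, 3}), ({1, 2}, {3, 4}), ({3, 4}, {1, 2}), ({2, 3}, {3, 4})])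
    (Z₁ Z₂ Z₃ : (Fin 5 → Fin 5) → ℂ)
    (hZ₁ : SlotInvariantOn {0, 1} Z₁ ∧ SlotInvariantOn {0, 1}ᶜ Z₁) (hZ₂ : SlotInvariantOn S₂ Z₂ ∧ SlotInvariantOn S₂ᶜ Z₂)
    (hZ₃ : SlotInvariantOn S₃ Z₃ ∧ SlotInvariantOn S₃ᶜ Z₃) (hsum : SlotInvariantOn Finset.univ (Z₁ + Z₂ + Z₃)) :
    SlotInvariantOn Finset.univ Z₁ ∧ SlotInvariantOn Finset.univ Z₂ ∧ SlotInvariantOn Finset.univ Z₃ := by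
  simp only [List.mem_cons, Prod.mk.injEq, List.mem_nil_iff, or_false] at hform
  rcases hform with ⟨rfl, rfl⟩ | ⟨rfl, rfl⟩ | ⟨rfl, rfl⟩ | ⟨rfl, rfl⟩ | ⟨rfl, rfl⟩ | ⟨rfl, rfl⟩ | ⟨rfl, rfl⟩ | ⟨rfl, rfl⟩
  · -- triangle
    exact threeSplit_separation_triangle Z₁ Z₂ Z₃ hZ₁ hZ₂ hZ₃ hsum
  · -- star
    exact threeSplit_separation_star Z₁ Z₂ Z₃ hZ₁ hZ₂ hZ₃ hsum
  · -- path, `S₁` an end edge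
    exact threeSplit_separation_path Z₁ Z₂ Z₃ hZ₁ hZ₂ hZ₃ hsum
  · -- path, `S₁` an end edge, other order
    obtain ⟨h1, h3, h2⟩ := threeSplit_separation_path Z₁ Z₃ Z₂ hZ₁ hZ₃ hZ₂ (sum_swap23 hsum)
    exact ⟨h1, h2, h3⟩
  · -- path, `S₁` the middle edge: relabel by `(0 2)` to the path `{1,2},{0,1},{2,3}` read as (Z₂', Z₁', Z₃')
    refine separation_transport {0, 1} {1, 2} {0, 3} Z₁ Z₂ Z₃ (Equiv.swap (0 : Fin 5) 2) ?_ hZ₁ hZ₂ hZ₃ hsum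
    intro W₁ W₂ W₃ hW₁ hW₂ hW₃ hW
    have e1 : (({0, 1} : Finset (Fin 5)).map (Equiv.swap (0 : Fin 5) 2).toEmbedding) = {1, 2} := by decide
    have e2 : (({1, 2} : Finset (Fin 5)).map (Equiv.swap (0 : Fin 5) 2).toEmbedding) = {0, 1} := by decide
    have e3 : (({0, 3} : Finset (Fin 5)).map (Equiv.swap (0 : Fin 5) 2).toEmbedding) = {2, 3} := by decide
    rw [e1] at hW₁; rw [e2] at hW₂; rw [e3] at hW₃
    obtain ⟨h2, h1, h3⟩ := threeSplit_separation_path W₂ W₁ W₃ hW₂ hW₁ hW₃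
      (by rw [show W₂ + W₁ + W₃ = W₁ + W₂ + W₃ from by abel]; exact hW)
    exact ⟨h1, h2, h3⟩
  · -- `P₃ ⊔ K₂`, `S₁` in the path
    exact threeSplit_separation_pathEdge Z₁ Z₂ Z₃ hZ₁ hZ₂ hZ₃ hsum
  · -- `P₃ ⊔ K₂`, `S₁` in the path, other order
    obtain ⟨h1, h3, h2⟩ := threeSplit_separation_pathEdge Z₁ Z₃ Z₂ hZ₁ hZ₃ hZ₂ (sum_swap23 hsum)
    exact ⟨h1, h2, h3⟩
  · -- `P₃ ⊔ K₂`, `S₁` the isolated edge: relabel so that the path part becomes `{0,1},{1,2}` and `S₁ ↦ {3,4}`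
    refine separation_transport {0, 1} {2, 3} {3, 4} Z₁ Z₂ Z₃
      (Equiv.swap (0 : Fin 5) 1 * Equiv.swap (0 : Fin 5) 3 * Equiv.swap (1 : Fin 5) 2 * Equiv.swap (1 : Fin 5) 4) ?_
      hZ₁ hZ₂ hZ₃ hsum
    intro W₁ W₂ W₃ hW₁ hW₂ hW₃ hW
    have e1 : (({0, 1} : Finset (Fin 5)).map
        (Equiv.swap (0 : Fin 5) 1 * Equiv.swap (0 : Fin 5) 3 * Equiv.swap (1 : Fin 5) 2 * Equiv.swap (1 : Fin 5) 4).toEmbedding)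
        = {3, 4} := by decide
    have e2 : (({2, 3} : Finset (Fin 5)).map
        (Equiv.swap (0 : Fin 5) 1 * Equiv.swap (0 : Fin 5) 3 * Equiv.swap (1 : Fin 5) 2 * Equiv.swap (1 : Fin 5) 4).toEmbedding)
        = {0, 1} := by decide
    have e3 : (({3, 4} : Finset (Fin 5)).map
        (Equiv.swap (0 : Fin 5) 1 * Equiv.swap (0 : Fin 5) 3 * Equiv.swap (1 : Fin 5) 2 * Equiv.swap (1 : Fin 5) 4).toEmbedding)
        = {1, 2} := by decide
    rw [e1] at hW₁; rw [e2] at hW₂; rw [e3] at hW₃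
    obtain ⟨h2, h3, h1⟩ := threeSplit_separation_pathEdge W₂ W₃ W₁ hW₂ hW₃ hW₁ (sum_rot hW)
    exact ⟨h1, h2, h3⟩

/-- The ten pair splits. [folklore] -/
theorem mem_pairs_of_card_two : ∀ X : Finset (Fin 5), X.card = 2 →
    X ∈ [({0, 1} : Finset (Fin 5)), {0, 2}, {0, 3}, {0, 4}, {1, 2}, {1, 3}, {1, 4}, {2, 3}, {2, 4}, {3, 4}] := by
  decide

/-- Classification of the two other splits under the stabiliser of `{0,1}` (twelve explicit permutations). [folklore] -/
theorem classify_stab01 : ∀ X ∈ [({0, 1} : Finset (Fin 5)), {0, 2}, {0, 3}, {0, 4}, {1, 2}, {1, 3}, {1, 4}, {2, 3}, {2, 4}, {3, 4}],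
    ∀ Y ∈ [({0, 1} : Finset (Fin 5)), {0, 2}, {0, 3}, {0, 4}, {1, 2}, {1, 3}, {1, 4}, {2, 3}, {2, 4}, {3, 4}],
    X ≠ {0, 1} → Y ≠ {0, 1} → X ≠ Y →
    ∃ ρ ∈ [(1 : Equiv.Perm (Fin 5)), Equiv.swap 2 3, Equiv.swap 2 4, Equiv.swap 3 4,
        Equiv.swap 2 3 * Equiv.swap 3 4, Equiv.swap 3 4 * Equiv.swap 2 3,
        Equiv.swap 0 1, Equiv.swap 0 1 * Equiv.swap 2 3, Equiv.swap 0 1 * Equiv.swap 2 4,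
        Equiv.swap 0 1 * Equiv.swap 3 4, Equiv.swap 0 1 * Equiv.swap 2 3 * Equiv.swap 3 4,
        Equiv.swap 0 1 * Equiv.swap 3 4 * Equiv.swap 2 3],
      (({0, 1} : Finset (Fin 5)).map ρ.toEmbedding = {0, 1}) ∧
      (X.map ρ.toEmbedding, Y.map ρ.toEmbedding) ∈
        [(({0, 2} : Finset (Fin 5)), ({1, 2} : Finset (Fin 5))), ({0, 2}, {0, 3}), ({1, 2}, {2, 3}),
          ({2, 3}, {1, 2}), ({1, 2}, {0, 3}), ({1, 2}, {3, 4}), ({3, 4}, {1, 2}), ({2, 3}, {3, 4})] := by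
  decide +kernel

/-- **Three-split separation** (young-shadow `stub_threeSplit_separation`, by name). [folklore] -/
theorem threeSplit_separation (S₁ S₂ S₃ : Finset (Fin 5)) (h₁ : S₁.card = 2) (h₂ : S₂.card = 2) (h₃ : S₃.card = 2)
    (h12 : S₁ ≠ S₂) (h13 : S₁ ≠ S₃) (h23 : S₂ ≠ S₃) (Z₁ Z₂ Z₃ : (Fin 5 → Fin 5) → ℂ)
    (hZ₁ : SlotInvariantOn S₁ Z₁ ∧ SlotInvariantOn S₁ᶜ Z₁) (hZ₂ : SlotInvariantOn S₂ Z₂ ∧ SlotInvariantOn S₂ᶜ Z₂)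
    (hZ₃ : SlotInvariantOn S₃ Z₃ ∧ SlotInvariantOn S₃ᶜ Z₃) (hsum : SlotInvariantOn Finset.univ (Z₁ + Z₂ + Z₃)) :
    SlotInvariantOn Finset.univ Z₁ ∧ SlotInvariantOn Finset.univ Z₂ ∧ SlotInvariantOn Finset.univ Z₃ := by
  classical
  -- stage 1: move `S₁` to `{0,1}`
  obtain ⟨p, q, hpq, rfl⟩ := Finset.card_eq_two.mp h₁
  obtain ⟨σ, hp, hq⟩ := LaplaceFiveSymmetricPieces.exists_perm_pair p q hpq
  refine separation_transport {p, q} S₂ S₃ Z₁ Z₂ Z₃ σ ?_ hZ₁ hZ₂ hZ₃ hsum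
  intro W₁ W₂ W₃ hW₁ hW₂ hW₃ hW
  have e1 : (({p, q} : Finset (Fin 5)).map σ.toEmbedding) = {0, 1} := by
    rw [Finset.map_insert, Finset.map_singleton]
    simp only [Equiv.coe_toEmbedding, hp, hq]
  rw [e1] at hW₁
  -- stage 2: classify the other two under the stabiliser of `{0,1}`
  have hX : (S₂.map σ.toEmbedding).card = 2 := by rw [Finset.card_map]; exact h₂
  have hY : (S₃.map σ.toEmbedding).card = 2 := by rw [Finset.card_map]; exact h₃
  have hX1 : S₂.map σ.toEmbedding ≠ {0, 1} := by
    rw [← e1]; exact fun h => h12 (Finset.map_injective _ h).symm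
  have hY1 : S₃.map σ.toEmbedding ≠ {0, 1} := by
    rw [← e1]; exact fun h => h13 (Finset.map_injective _ h).symm
  have hXY : S₂.map σ.toEmbedding ≠ S₃.map σ.toEmbedding := fun h => h23 (Finset.map_injective _ h)
  obtain ⟨ρ, -, hρ01, hρform⟩ := classify_stab01 _ (mem_pairs_of_card_two _ hX) _ (mem_pairs_of_card_two _ hY)
    hX1 hY1 hXY
  refine separation_transport {0, 1} _ _ W₁ W₂ W₃ ρ ?_ hW₁ hW₂ hW₃ hW
  intro V₁ V₂ V₃ hV₁ hV₂ hV₃ hV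
  rw [hρ01] at hV₁
  exact separation_normalForms _ _ hρform V₁ V₂ V₃ hV₁ hV₂ hV₃ hV

end LaplaceFiveThreeSplit

end Summit.ValiantsHypothesis.ValiantsHypothesis.Theorems.RigidityForcesSymmetryRankRigidMinimalRepr
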